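import Mathlib
import Literature.Computability.AlgebraicComplexity.NonscalarComputation
import HarnessLib

/-!
# The Baur–Strassen derivative inequality in the nonscalar model

Topic `Literature/Computability/AlgebraicComplexity`. Second support file for the formalisation of
Andrews 2022, Theorem 3 (`DeterminantalIdealComplexity.lean`). Andrews' Lemma 2 ([BS83]):
"Let `f(x) ∈ 𝔽[x]` be a polynomial computed by an algebraic circuit of multiplicative complexity
`s`. Then there is a multi-output algebraic circuit of multiplicative complexity `3s` that computes
`{f, ∂f/∂x₁, …, ∂f/∂xₙ}`." We prove it for nonscalar computation sequences
(`NonscalarComputation.lean`): if `f` lies in the cost-free span of a nonscalar computation sequence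
of length `≤ s`, then all first-order partial derivatives of `f` lie in the cost-free span of ONE
nonscalar computation sequence of length `≤ 3s` (Baur–Strassen 1983, Thm. 1 in the form of
Bürgisser–Clausen–Shokrollahi 1997, Thm. (7.7) "derivative inequality", nonscalar cost).

## Proof (Morgenstern's inductive form of the Baur–Strassen argument, BCS 1997, proof of (7.7))

Induction on `s`, peeling off the OLDEST multiplication `g₁ = u₁ · v₁` (`u₁, v₁` affine-linear).
The remaining `s - 1` multiplications form a computation sequence in `R[X_σ, y]` (`y` a new
variable standing for `g₁`; `IsNonscalarSeq.exists_lift`) computing some `P(X, y)` with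
`P(X, g₁) = f`. By induction all `∂P/∂Xᵢ`, `∂P/∂y` are jointly computable with `3(s-1)`
multiplications; substituting `y ↦ g₁` costs the single multiplication `g₁ = u₁ v₁`
(`IsNonscalarSeq.aeval_append`), and the chain rule (`pderiv_aeval_optionElim`)
`∂f/∂Xᵢ = (∂P/∂Xᵢ)(X, g₁) + (∂P/∂y)(X, g₁) · (aᵢ v₁ + bᵢ u₁)` (`aᵢ = ∂u₁/∂Xᵢ`, `bᵢ = ∂v₁/∂Xᵢ`
constants) needs two more: `(∂P/∂y)(X, g₁) · v₁` and `(∂P/∂y)(X, g₁) · u₁`. Total `≤ 3s`.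

## References

* [BaurStrassen1983] W. Baur, V. Strassen, *The complexity of partial derivatives*, Theoret.
  Comput. Sci. 22 (1983), Thm. 1.
* [BurgisserClausenShokrollahi1997] P. Bürgisser, M. Clausen, M. A. Shokrollahi, *Algebraic
  Complexity Theory*, 1997, Thm. (7.7) and its proof (derivative inequality, nonscalar model).
* [Andrews2022] R. Andrews, FOCS 2022, arXiv:2208.01078, Lemma 2.
-/

noncomputable section

open MvPolynomial

namespace Literature.Computability.AlgebraicComplexity

universe u v

variable {R : Type u} [CommSemiring R]

section Tools

variable {σ : Type v}

/-- `freeSpan S ≤ M` as soon as `M` contains `1`, the variables and `S`.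
[cite: BurgisserClausenShokrollahi1997, §4.1] -/
theorem freeSpan_le_of_mem {S : Set (MvPolynomial σ R)} {M : Submodule R (MvPolynomial σ R)}
    (h1 : (1 : MvPolynomial σ R) ∈ M) (hX : ∀ i, (X i : MvPolynomial σ R) ∈ M)
    (hS : ∀ s ∈ S, s ∈ M) : freeSpan S ≤ M := by
  have h := freeSpan_le_comap (LinearMap.id (R := R) (M := MvPolynomial σ R)) (M := M) h1 hX hS
  simpa using h

/-- The partial derivatives of an affine-linear form (an element of `freeSpan ∅`) are constants.
[cite: BurgisserClausenShokrollahi1997, proof of Thm. (7.7)] -/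
theorem exists_pderiv_eq_C_of_mem_freeSpan_empty {u : MvPolynomial σ R}
    (hu : u ∈ freeSpan (∅ : Set (MvPolynomial σ R))) (i : σ) :
    ∃ c : R, pderiv i u = C c := by
  classical
  induction hu using Submodule.span_induction with
  | mem x hx =>
    rcases hx with rfl | ⟨j, rfl⟩ | hx
    · exact ⟨0, by simp⟩
    · by_cases hij : j = i
      · subst hij
        exact ⟨1, by simp⟩
      · exact ⟨0, by simp [pderiv_X_of_ne hij]⟩
    · exact absurd hx (Set.notMem_empty _)
  | zero => exact ⟨0, by simp⟩
  | add x y _ _ hx hy =>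
    obtain ⟨a, ha⟩ := hx
    obtain ⟨b, hb⟩ := hy
    exact ⟨a + b, by simp [ha, hb]⟩
  | smul a x _ hx =>
    obtain ⟨c, hc⟩ := hx
    exact ⟨a * c, by simp [hc, smul_eq_C_mul]⟩

/-- All partial derivatives of a cost-free polynomial of the EMPTY sequence are cost-free
(they are constants). [cite: BurgisserClausenShokrollahi1997, proof of Thm. (7.7)] -/
theorem pderiv_mem_freeSpan_of_mem_freeSpan_empty {p : MvPolynomial σ R}
    (hp : p ∈ freeSpan (∅ : Set (MvPolynomial σ R))) (i : σ) :
    pderiv i p ∈ freeSpan (∅ : Set (MvPolynomial σ R)) := by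
  obtain ⟨c, hc⟩ := exists_pderiv_eq_C_of_mem_freeSpan_empty hp i
  rw [hc]
  exact C_mem_freeSpan _ c

/-- The substitution `y ↦ g`, `Xᵢ ↦ Xᵢ` from `R[X_σ, y]` (`y = X none`) to `R[X_σ]`. [folklore] -/
abbrev substLast (g : MvPolynomial σ R) : MvPolynomial (Option σ) R →ₐ[R] MvPolynomial σ R :=
  aeval fun o : Option σ => Option.elim o g X

/-- `substLast g` on the old variables. [folklore] -/
@[simp] theorem substLast_X_some (g : MvPolynomial σ R) (i : σ) :
    substLast g (X (some i)) = X i := by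
  simp [substLast]

/-- `substLast g` on the new variable. [folklore] -/
@[simp] theorem substLast_X_none (g : MvPolynomial σ R) :
    substLast g (X none) = g := by
  simp [substLast]

/-- **Chain rule** for the substitution `y ↦ g`:
`∂ᵢ (P(X, g)) = (∂_{Xᵢ} P)(X, g) + (∂_y P)(X, g) · ∂ᵢ g`. [folklore] -/
theorem pderiv_substLast (g : MvPolynomial σ R) (P : MvPolynomial (Option σ) R) (i : σ) :
    pderiv i (substLast g P) =
      substLast g (pderiv (some i) P) + substLast g (pderiv none P) * pderiv i g := by
  classical
  induction P using MvPolynomial.induction_on with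
  | C a => simp
  | add p q hp hq =>
    simp only [map_add, hp, hq]
    ring
  | mul_X p o hp =>
    have key : pderiv i (substLast g (X o)) =
        substLast g (pderiv (some i) (X o)) + substLast g (pderiv none (X o)) * pderiv i g := by
      cases o with
      | none =>
        rw [substLast_X_none, pderiv_X_of_ne (Option.some_ne_none i).symm, pderiv_X_self, map_zero,
          map_one, zero_add, one_mul]
      | some j =>
        rw [substLast_X_some, pderiv_X_of_ne (Option.some_ne_none j), map_zero, zero_mul, add_zero]
        by_cases hij : j = i
        · subst hij
          rw [pderiv_X_self, pderiv_X_self, map_one]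
        · rw [pderiv_X_of_ne hij, pderiv_X_of_ne (by simpa using hij), map_zero]
    rw [map_mul, pderiv_mul, hp, key, pderiv_mul, pderiv_mul]
    simp only [map_add, map_mul]
    ring

/-- **Lifting the tail of a computation sequence over its oldest element**: if `gs ++ [g]` is a
nonscalar computation sequence in `R[X_σ]`, then `gs` lifts to a computation sequence `Gs` in
`R[X_σ, y]` of the same length (the oldest product `g` becomes the free variable `y`), and every
cost-free polynomial of `gs ++ [g]` is `P(X, g)` for some cost-free `P` of `Gs`
(BCS 1997, proof of Thm. (7.7)). [cite: BurgisserClausenShokrollahi1997, proof of Thm. (7.7)] -/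
theorem IsNonscalarSeq.exists_lift (g : MvPolynomial σ R) :
    ∀ gs : List (MvPolynomial σ R), IsNonscalarSeq (gs ++ [g]) →
      ∃ Gs : List (MvPolynomial (Option σ) R), IsNonscalarSeq Gs ∧ Gs.length = gs.length ∧
        ∀ p ∈ freeSpan {x | x ∈ gs ++ [g]}, ∃ P ∈ freeSpan {x | x ∈ Gs}, substLast g P = p := by
  intro gs
  induction gs with
  | nil =>
    intro _
    refine ⟨[], isNonscalarSeq_nil, rfl, fun p hp => ?_⟩
    have hle : freeSpan {x | x ∈ ([] : List (MvPolynomial σ R)) ++ [g]} ≤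
        (freeSpan {x | x ∈ ([] : List (MvPolynomial (Option σ) R))}).map
          (substLast g).toLinearMap := by
      refine freeSpan_le_of_mem ?_ ?_ ?_
      · exact ⟨1, one_mem_freeSpan _, by simp⟩
      · exact fun i => ⟨X (some i), X_mem_freeSpan _ _, by simp⟩
      · intro s hs
        simp only [List.nil_append, Set.mem_setOf_eq, List.mem_singleton] at hs
        subst hs
        exact ⟨X none, X_mem_freeSpan _ _, by simp⟩
    obtain ⟨P, hP, hPp⟩ := Submodule.mem_map.1 (hle hp)
    exact ⟨P, hP, hPp⟩
  | cons g' gs ih =>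
    rintro ⟨h0, u, hu, v, hv, rfl⟩
    obtain ⟨Gs, hGs, hlen, hlift⟩ := ih h0
    obtain ⟨U, hU, hUu⟩ := hlift u hu
    obtain ⟨V, hV, hVv⟩ := hlift v hv
    refine ⟨(U * V) :: Gs, ⟨hGs, U, hU, V, hV, rfl⟩, by simp [hlen], fun p hp => ?_⟩
    have hmono : freeSpan {x | x ∈ Gs} ≤ freeSpan {x | x ∈ (U * V) :: Gs} :=
      freeSpan_mono fun x hx => List.mem_cons_of_mem _ hx
    have hle : freeSpan {x | x ∈ (u * v) :: gs ++ [g]} ≤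
        (freeSpan {x | x ∈ (U * V) :: Gs}).map (substLast g).toLinearMap := by
      refine freeSpan_le_of_mem ?_ ?_ ?_
      · exact ⟨1, one_mem_freeSpan _, by simp⟩
      · exact fun i => ⟨X (some i), X_mem_freeSpan _ _, by simp⟩
      · intro s hs
        simp only [List.cons_append, Set.mem_setOf_eq, List.mem_cons] at hs
        rcases hs with rfl | hs
        · exact ⟨U * V, mem_freeSpan_of_mem (by simp),
            by rw [AlgHom.toLinearMap_apply, map_mul, hUu, hVv]⟩
        · obtain ⟨P, hP, hPs⟩ := hlift s (mem_freeSpan_of_mem hs)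
          exact ⟨P, hmono hP, hPs⟩
    obtain ⟨P, hP, hPp⟩ := Submodule.mem_map.1 (hle hp)
    exact ⟨P, hP, hPp⟩

end Tools

/-- **Baur–Strassen in the nonscalar model (derivative inequality, BCS 1997, Thm. (7.7);
Andrews 2022, Lemma 2).** If `p` lies in the cost-free span of a nonscalar computation sequence of
length `≤ s`, then there is ONE nonscalar computation sequence of length `≤ 3s` whose cost-free
span contains every first-order partial derivative `∂p/∂Xᵢ`.
[cite: BaurStrassen1983, Thm. 1 (via BurgisserClausenShokrollahi1997 Thm. (7.7))] -/
theorem IsNonscalarSeq.exists_forall_pderiv_mem :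
    ∀ (s : ℕ) {σ : Type v} (gs : List (MvPolynomial σ R)) (p : MvPolynomial σ R),
      IsNonscalarSeq gs → gs.length ≤ s → p ∈ freeSpan {x | x ∈ gs} →
        ∃ gs' : List (MvPolynomial σ R), IsNonscalarSeq gs' ∧ gs'.length ≤ 3 * s ∧
          ∀ i, pderiv i p ∈ freeSpan {x | x ∈ gs'} := by
  intro s
  induction s with
  | zero =>
    intro σ gs p _ hlen hp
    have hgs0 : gs = [] := List.eq_nil_of_length_eq_zero (Nat.le_zero.1 hlen)
    subst hgs0
    have he : {x : MvPolynomial σ R | x ∈ ([] : List (MvPolynomial σ R))} = ∅ := by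
      ext x
      simp
    refine ⟨[], isNonscalarSeq_nil, by simp, fun i => ?_⟩
    rw [he] at hp ⊢
    exact pderiv_mem_freeSpan_of_mem_freeSpan_empty hp i
  | succ s ih =>
    intro σ gs p hgs hlen hp
    by_cases hlt : gs.length ≤ s
    · obtain ⟨gs', h1, h2, h3⟩ := ih gs p hgs hlt hp
      exact ⟨gs', h1, by omega, h3⟩
    -- `gs = gs₀ ++ [g₁]` with `g₁ = u₁ v₁` the oldest multiplication
    rcases List.eq_nil_or_concat gs with hnil | ⟨gs₀, g₁, hcat⟩
    · subst hnil
      simp at hlt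
    rw [List.concat_eq_append] at hcat
    subst hcat
    have hlen₀ : gs₀.length ≤ s := by
      simp only [List.length_append, List.length_singleton] at hlen
      omega
    obtain ⟨u₁, hu₁, v₁, hv₁, hg₁⟩ := hgs.oldest
    have hg1seq : IsNonscalarSeq [g₁] := hgs.of_append
    -- lift the tail over `y := g₁` and differentiate it by induction
    obtain ⟨Gs, hGs, hGslen, hlift⟩ := IsNonscalarSeq.exists_lift g₁ gs₀ hgs
    obtain ⟨P, hP, hPp⟩ := hlift p hp
    obtain ⟨Gs', hGs', hGs'len, hder⟩ := ih Gs P hGs (hGslen ▸ hlen₀) hP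
    -- substitute `y ↦ g₁` back (one multiplication: `g₁` itself)
    have hθ : ∀ o : Option σ, (Option.elim o g₁ X : MvPolynomial σ R) ∈
        freeSpan {x | x ∈ [g₁]} := by
      rintro (_ | i)
      · exact mem_freeSpan_of_mem (by simp)
      · exact X_mem_freeSpan _ i
    obtain ⟨hseq₁, hspan₁⟩ := IsNonscalarSeq.aeval_append hθ hg1seq hGs'
    set seq₁ := Gs'.map (substLast g₁) ++ [g₁] with hseq₁_def
    set D := substLast g₁ (pderiv none P) with hD
    have hDmem : D ∈ freeSpan {x | x ∈ seq₁} := hspan₁ _ (hder none)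
    have hempty : (∅ : Set (MvPolynomial σ R)) ⊆ {x | x ∈ seq₁} := Set.empty_subset _
    -- two more multiplications
    set seq₂ := (D * u₁) :: (D * v₁) :: seq₁ with hseq₂_def
    have hmono₁ : freeSpan {x | x ∈ seq₁} ≤ freeSpan {x | x ∈ (D * v₁) :: seq₁} :=
      freeSpan_mono fun x hx => List.mem_cons_of_mem _ hx
    have hmono₂ : freeSpan {x | x ∈ (D * v₁) :: seq₁} ≤ freeSpan {x | x ∈ seq₂} :=
      freeSpan_mono fun x hx => List.mem_cons_of_mem _ hx
    have hseq₂ : IsNonscalarSeq seq₂ :=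
      ⟨⟨hseq₁, D, hDmem, v₁, freeSpan_mono hempty hv₁, rfl⟩, D, hmono₁ hDmem, u₁,
        freeSpan_mono (Set.empty_subset _) hu₁, rfl⟩
    refine ⟨seq₂, hseq₂, ?_, fun i => ?_⟩
    · simp only [hseq₂_def, hseq₁_def, List.length_cons, List.length_append, List.length_map,
        List.length_nil]
      omega
    -- chain rule
    obtain ⟨a, ha⟩ := exists_pderiv_eq_C_of_mem_freeSpan_empty hu₁ i
    obtain ⟨b, hb⟩ := exists_pderiv_eq_C_of_mem_freeSpan_empty hv₁ i
    have hchain : pderiv i p = substLast g₁ (pderiv (some i) P) + (a • (D * v₁) + b • (D * u₁)) := by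
      rw [← hPp, pderiv_substLast, ← hD, hg₁, pderiv_mul, ha, hb, smul_eq_C_mul, smul_eq_C_mul]
      ring
    rw [hchain]
    refine add_mem (hmono₂ (hmono₁ (hspan₁ _ (hder (some i))))) (add_mem ?_ ?_)
    · exact Submodule.smul_mem _ _ (hmono₂ (mem_freeSpan_of_mem (by simp)))
    · exact Submodule.smul_mem _ _ (mem_freeSpan_of_mem (by simp [hseq₂_def]))

/-- **Baur–Strassen, packaged**: from a nonscalar computation sequence of length `≤ s` for `p` to
one of length `≤ 3s` for all `∂p/∂Xᵢ` simultaneously. [cite: BaurStrassen1983, Thm. 1 (via BurgisserClausenShokrollahi1997 Thm. (7.7))] -/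
theorem exists_isNonscalarSeq_forall_pderiv {σ : Type v} {s : ℕ} {p : MvPolynomial σ R}
    (h : ∃ gs : List (MvPolynomial σ R), IsNonscalarSeq gs ∧ gs.length ≤ s ∧
      p ∈ freeSpan {x | x ∈ gs}) :
    ∃ gs' : List (MvPolynomial σ R), IsNonscalarSeq gs' ∧ gs'.length ≤ 3 * s ∧
      ∀ i, pderiv i p ∈ freeSpan {x | x ∈ gs'} := by
  obtain ⟨gs, h1, h2, h3⟩ := h
  exact IsNonscalarSeq.exists_forall_pderiv_mem s gs p h1 h2 h3

end Literature.Computability.AlgebraicComplexity
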